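import Literature.NumberTheory.PAdicHodge.FontaineDpst
import Literature.NumberTheory.GaloisRepresentations.LocalGaloisGroupInertiaProofs
import HarnessLib

/-!
# The de Rham property is insensitive to a finite extension of the `p`-adic base field

Brinon–Conrad, *CMI Summer School notes on `p`-adic Hodge theory* (2009), Prop. 6.3.8 (p. 80):
"For any complete discretely-valued extension `K'/K` inside of `C_K` and any `V ∈ Rep_{ℚ_p}(G_K)`,
the natural map `K' ⊗_K D_{dR,K}(V) → D_{dR,K'}(V)` is an isomorphism in `Fil_{K'}`. In particular,
`V` is de Rham as a `G_K`-representation if and only if `V` is de Rham as a `G_{K'}`-representation.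
As special cases, the de Rham property for `G_K` … is insensitive to replacing `K` with a finite
extension inside of `C_K`."  (Fontaine 1994, Exp. III §1.5, §3: `D_dR` commutes with finite base
change; the construction of `B_dR⁺` depends only on `𝒪_{C_K}` with its `G_K`-action.)

## What is here

* `DeRhamBaseChange` — NAMED FACT (D-0014), the special case the tree can phrase and the summit
  `Langlands` consumes (crux `ReciprocityTRCM`, line `pieces`, stub `stub_deRhamBaseChange_local`):
  for a CONTINUOUS embedding `K → L` of characteristic-`0` non-archimedean local fields of residue
  characteristic `ℓ` and a framed `ρ : Γ_K →ₜ* GL_n(ℚ̄_ℓ)` which is de Rham for THE pinned datum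
  `fontainePst K ℓ hK` (whose period ring IS the constructed `B_dR(K)`,
  `fontainePst_𝔅_eq_bdRPeriodRingData`, so "de Rham" is Fontaine's `B_dR(K)`-admissibility of a
  `ℚ_ℓ`-model), the restriction `ρ ∘ res_{L/K}` along the tree's restriction map
  `absGaloisRestrict K L : Γ_L →ₜ* Γ_K` (the chosen `K̄ → L̄`, an isomorphism onto `L̄` since `L/K`
  is finite, well defined up to conjugation) is de Rham for `fontainePst L ℓ hL`.
  In print this is Prop. 6.3.8 with `K' = L` after transporting `B_dR(L)` (built in the tree from
  `C_L = \widehat{L̄}`, file `BdRPeriodRingData`) to `B_dR(K)` along the isometric isomorphism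
  `\widehat{K̄} ≅ \widehat{L̄}` induced by the chosen `K̄ ≅ L̄` — a functoriality of the tree's
  `B_dR` construction that is not yet formalised, which is why the statement is a named fact here
  and not a theorem.
* `DeRhamBaseChange.of_finite_range` — the finite-image sector holds outright (finite-image
  representations are de Rham for THE datum, `fontainePst_isDeRhamFramed_of_finite_range`).
* `DeRhamBaseChange.of_isLocallyUnramified` — the unramified sector holds outright (`res(I_L) ≤ I_K`
  and unramified ⇒ de Rham for every datum).

## What is deliberately NOT here

* The general form (TODO): `K' ⊗_K D_{dR,K}(V) ≅ D_{dR,K'}(V)` in `Fil_{K'}` for every complete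
  discretely-valued `K'/K ⊆ C_K` (e.g. `K' = \widehat{K^{un}}`), and the converse direction
  (de Rham over `L` ⇒ de Rham over `K`), which the summit does not consume.
* No `sorry`, no new axiom.

## References

* [BrinonConrad2009] O. Brinon, B. Conrad, *CMI Summer School notes on p-adic Hodge theory*
  (2009), Prop. 6.3.8 (p. 80), and the discussion preceding it (p. 80, "the construction of
  `B_dR⁺` … only depends on `𝒪_{C_K}` endowed with its `G_K`-action").
* [FontaineAsterisque223III] J.-M. Fontaine, *Représentations p-adiques semi-stables*,
  Astérisque 223 (1994), Exp. III §1.5, §3.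
-/

noncomputable section

open Field ValuativeRel
open Literature.NumberTheory.GaloisRepresentations

namespace Literature.NumberTheory.PAdicHodge

/-- **The de Rham property is insensitive to a finite extension of the base field** (Brinon–Conrad
2009, Prop. 6.3.8; Fontaine 1994, Exp. III §1.5, §3), tree form for THE pinned data: for a continuous
embedding `K → L` of characteristic-`0` non-archimedean local fields of residue characteristic `ℓ`
(`hK : |ℓ|_K < 1`, `hL : |ℓ|_L < 1`) and a framed `ρ : Γ_K →ₜ* GL_n(ℚ̄_ℓ)` de Rham for
`fontainePst K ℓ hK` (i.e. `B_dR(K)`-admissible on a `ℚ_ℓ`-model), the restriction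
`ρ ∘ absGaloisRestrict K L : Γ_L →ₜ* GL_n(ℚ̄_ℓ)` is de Rham for `fontainePst L ℓ hL`.
Named fact (D-0014): discharging it is the transport of the tree's `B_dR(L)` to `B_dR(K)` along
`\widehat{K̄} ≅ \widehat{L̄}` followed by Prop. 6.3.8 (`L ⊗_K D_{dR,K}(V) ≅ D_{dR,L}(V)`).
-- TODO(general form): `K' ⊗_K D_{dR,K}(V) ≅ D_{dR,K'}(V)` for every complete discretely-valued `K'/K ⊆ C_K`, and the converse.
[cite: BrinonConrad2009, Prop. 6.3.8] -/
def DeRhamBaseChange : Prop :=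
  ∀ (K L : Type) [Field K] [ValuativeRel K] [TopologicalSpace K] [IsNonarchimedeanLocalField K]
    [CharZero K] [Field L] [ValuativeRel L] [TopologicalSpace L] [IsNonarchimedeanLocalField L]
    [CharZero L] [Algebra K L], Continuous (algebraMap K L) →
    ∀ (ℓ : ℕ) [Fact ℓ.Prime] (hK : valuation K (ℓ : K) < 1) (hL : valuation L (ℓ : L) < 1) (n : ℕ)
      (ρ : FramedRep (absoluteGaloisGroup K) (PadicAlgCl ℓ) n),
      (fontainePst K ℓ hK).IsDeRhamFramed ρ →
        (fontainePst L ℓ hL).IsDeRhamFramed (ρ.comp (absGaloisRestrict K L))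

namespace DeRhamBaseChange

variable {K L : Type} [Field K] [ValuativeRel K] [TopologicalSpace K] [IsNonarchimedeanLocalField K]
  [CharZero K] [Field L] [ValuativeRel L] [TopologicalSpace L] [IsNonarchimedeanLocalField L]
  [CharZero L] [Algebra K L] {ℓ : ℕ} [Fact ℓ.Prime]

omit [ValuativeRel K] [TopologicalSpace K] [IsNonarchimedeanLocalField K] [CharZero K] in
/-- **The finite-image sector of `DeRhamBaseChange` holds outright** (no continuity needed): if `ρ`
has finite image then so has `ρ ∘ res_{L/K}`, and finite-image representations are de Rham for THE
datum (`fontainePst_isDeRhamFramed_of_finite_range`: Hilbert 90 over a finite splitting field,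
`L̄ ↪ B_dR⁺`). [cite: FontaineAsterisque223III, Exp. III §1.5 and §3] -/
theorem of_finite_range (hL : valuation L (ℓ : L) < 1) {n : ℕ}
    (ρ : FramedRep (absoluteGaloisGroup K) (PadicAlgCl ℓ) n) (hρ : (Set.range ρ).Finite) :
    (fontainePst L ℓ hL).IsDeRhamFramed (ρ.comp (absGaloisRestrict K L)) := by
  refine fontainePst_isDeRhamFramed_of_finite_range hL _ (hρ.subset ?_)
  rintro _ ⟨σ, rfl⟩
  exact ⟨absGaloisRestrict K L σ, rfl⟩

omit [CharZero K] in
/-- **The unramified sector of `DeRhamBaseChange` holds outright**: if `ρ` is trivial on the inertia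
group `I_K` then `ρ ∘ res_{L/K}` is trivial on `I_L` (restriction maps `I_L` into `I_K`,
`absInertia_map_absGaloisRestrict_le_holds`; Serre, *Local Fields* I §7 Prop. 22), and unramified
representations are de Rham for every datum (structure axiom `isDeRhamWith_of_isLocallyUnramified`:
unramified ⇒ crystalline ⇒ de Rham). [cite: FontaineAsterisque223III, Exp. III §5] -/
theorem of_isLocallyUnramified (hL : valuation L (ℓ : L) < 1) {n : ℕ}
    (ρ : FramedRep (absoluteGaloisGroup K) (PadicAlgCl ℓ) n) (hρ : ρ.IsLocallyUnramified) :
    (fontainePst L ℓ hL).IsDeRhamFramed (ρ.comp (absGaloisRestrict K L)) := by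
  refine (fontainePst L ℓ hL).isDeRhamFramed_of_isLocallyUnramified fun σ hσ => ?_
  rw [ContinuousMonoidHom.comp_toFun]
  exact hρ _ (absInertia_map_absGaloisRestrict_le_holds K L ⟨σ, hσ, rfl⟩)

end DeRhamBaseChange

/-- **De Rham DESCENT along a finite extension, for THE pinned Fontaine data** (Brinon–Conrad 2009,
Prop. 6.3.8: for `V ∈ Rep_{ℚ_p}(G_K)` and `K'/K` finite, `K' ⊗_K D_{dR,K}(V) ≃ D_{dR,K'}(V)`, "so `V` is
de Rham as a `G_K`-representation if and only if it is de Rham as a `G_{K'}`-representation"; the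
converse direction of `DeRhamBaseChange`, stated globally for number fields `K ⊆ L` and the pinned data
`fontainePstAdicCompletion` through the decomposition groups `FramedGaloisRep.toLocal`): if `ρ|_{Γ_L}`
is de Rham at every place `w ∣ ℓ` of `L` then `ρ` is de Rham at every place `v ∣ ℓ` of `K`.
Named fact (D-0014), wanted by the summit `Langlands` (crux `AscentConjugationSolvable`,
stmt-Langlands-1094, stub `isGeometricFramed_of_restrictField_of_deRhamDescent`, whose first hypothesis
is this Prop verbatim): discharging it is, at a place `w ∣ v` (`L_w / K_v` finite), Prop. 6.3.8 for
`K' = L_w` after transporting the tree's `B_dR(L_w)` to `B_dR(K_v)` along `\widehat{K̄_v} ≅ \widehat{L̄_w}`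
and the change of frame `exists_toLocal_restrictField_eq_conj`.
-- TODO(general form): the local statement for an arbitrary finite extension of `ℓ`-adic fields and the isomorphism of filtered modules `K' ⊗_K D_{dR,K}(V) ≅ D_{dR,K'}(V)`.
[cite: BrinonConrad2009, Prop. 6.3.8] [cite: SerreAbelianLadic1968, Ch. I §2.1] -/
def DeRhamRestrictFieldDescent : Prop :=
  ∀ (K L : Type) [Field K] [NumberField K] [Field L] [NumberField L] [Algebra K L] (ℓ : ℕ)
    [Fact ℓ.Prime] (n : ℕ) (ρ : FramedGaloisRep K (PadicAlgCl ℓ) n),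
    (∀ (w : IsDedekindDomain.HeightOneSpectrum (NumberField.RingOfIntegers L))
        (hw : ((ℓ : ℕ) : NumberField.RingOfIntegers L) ∈ w.asIdeal),
      (fontainePstAdicCompletion w ℓ hw).IsDeRhamFramed ((ρ.restrictField L).toLocal w)) →
    ∀ (v : IsDedekindDomain.HeightOneSpectrum (NumberField.RingOfIntegers K))
      (hv : ((ℓ : ℕ) : NumberField.RingOfIntegers K) ∈ v.asIdeal),
      (fontainePstAdicCompletion v ℓ hv).IsDeRhamFramed (ρ.toLocal v)

end Literature.NumberTheory.PAdicHodge

end
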